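import Summits.CriticalPhenomena.PercolationContinuityZ3.Theorems.PercNearOneGluingNoHeavyLowerTailSahiE3ProductSections
import Summits.CriticalPhenomena.PercolationContinuityZ3.Theorems.PercNearOneGluingNoHeavyLowerTailSahiE3LayerCake
import Mathlib.Tactic.Linarith
import Mathlib.Tactic.Ring
import Mathlib.Tactic.Positivity
import HarnessLib
import HarnessLib.Audit

/-!
# `NoHeavyLowerTail` (crux stmt-CriticalPhenomena-4575), Sahi programme P4: section profiles of up-sets of `B × Q` for a block `B`
# with a top (block OR-step, file 4 — bookkeeping)

Support file (cell `prim-l12`, seat P4, generation 15; `--supports stmt-CriticalPhenomena-4575`).  No named facts, no sorries;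
standard axioms; def-free.

`B` a finite poset with a top element `t` and weights `w ≥ 0` (`p = w t`, `q = Σ_{b ≠ t} w b`), `Q` a finite poset with weights `ν'`,
layered weight `ν(b,s) = w_b ν'(s)` on `B × Q`, slot `U = {(b,s) | b = t ∨ s ∈ G}`.  For `S ⊆ B × Q` the SECTION PROFILES on `Q` are
`a_S(s) = [ (t,s) ∈ S ]`, `f_S(s) = Σ_{b ≠ t} w_b [ (b,s) ∈ S ]`, `h_{S,S'}(s) = Σ_{b ≠ t} w_b [ (b,s) ∈ S ∩ S' ]` (written inline, no
definitions).  This file expresses the masses `ν(S)`, `ν(S ∩ U)`, `ν(U)`, `ν(Uᶜ)`, `ν(univ)` and the retained mass of the flat composite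
certificate on `S ∩ S' ∩ U` through the profiles (`mass_profile`, `mass_inter_slot_profile`, …, `retained_profile`), records the
pointwise constraints of the profiles of UP-SETS (`{0,1}`-valued, monotone, `0 ≤ f ≤ q a`, `0 ≤ h ≤ f, f'`) and the pointwise form of
Harris' inequality on the block (`harrisB_profile`), and computes the flow sums of the certificate (`flow_in`, `flow_out_top`,
`flow_out_low`).  Consumed by `…SahiE3BlockOrStep`.  HOME prim-l12-p4/FROM-prim-l12-p4-gen15-BLOCK-OR-STEP.md.
-/

namespace Summit.CriticalPhenomena.PercolationContinuityZ3.Theorems.SahiE3BlockLayers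

open Finset SahiE3ProductSections SahiE3LayerCake
open scoped BigOperators

variable {B Q : Type*} [Fintype B] [DecidableEq B] [Fintype Q] [DecidableEq Q]

/-! ### Masses through profiles -/

/-- Mass of `X ⊆ B × Q` for the layered weight, by `B`-sections: `ν(X) = Σ_s ν'(s) Σ_b w_b [ (b,s) ∈ X ]`. [folklore] -/
theorem mass_eq (w : B → ℝ) (ν' : Q → ℝ) (ν : B × Q → ℝ) (hν : ∀ b s, ν (b, s) = w b * ν' s) (X : Finset (B × Q)) :
    ∑ x ∈ X, ν x = ∑ s, ν' s * ∑ b, (if (b, s) ∈ X then w b else 0) := by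
  rw [sum_sectionsB]
  refine Finset.sum_congr rfl fun s _ => ?_
  rw [Finset.sum_filter, Finset.mul_sum]
  refine Finset.sum_congr rfl fun b _ => ?_
  split_ifs <;> simp [hν, mul_comm]

/-- Splitting off the top coordinate: `Σ_b w_b [P b] = w_t [P t] + Σ_{b ≠ t} w_b [P b]`. [folklore] -/
theorem sum_split_top (w : B → ℝ) (t : B) (P : B → Prop) [DecidablePred P] :
    ∑ b, (if P b then w b else 0) = (if P t then w t else 0) + ∑ b ∈ univ.erase t, (if P b then w b else 0) := by
  rw [← Finset.add_sum_erase univ _ (Finset.mem_univ t)]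

/-- `ν(S) = p·ν'(a_S) + ν'(f_S)`. [this work] -/
theorem mass_profile (w : B → ℝ) (ν' : Q → ℝ) (ν : B × Q → ℝ) (hν : ∀ b s, ν (b, s) = w b * ν' s) (t : B)
    (S : Finset (B × Q)) :
    ∑ x ∈ S, ν x = w t * ∑ s, ν' s * (if (t, s) ∈ S then (1:ℝ) else 0)
      + ∑ s, ν' s * ∑ b ∈ univ.erase t, (if (b, s) ∈ S then w b else 0) := by
  rw [mass_eq w ν' ν hν, Finset.mul_sum, ← Finset.sum_add_distrib]
  refine Finset.sum_congr rfl fun s _ => ?_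
  rw [sum_split_top w t]
  split_ifs <;> ring

omit [DecidableEq B] in
/-- `Σ_s [s ∉ G] F(s) = Σ_{s ∈ Gᶜ} F(s)`. [folklore] -/
theorem sum_ite_not_mem_univB (G : Finset Q) (F : Q → ℝ) :
    ∑ s, (if s ∈ G then 0 else F s) = ∑ s ∈ Gᶜ, F s := by
  have e : ∀ s, (if s ∈ G then (0:ℝ) else F s) = (if s ∈ Gᶜ then F s else 0) := by
    intro s; by_cases hs : s ∈ G
    · have : s ∉ Gᶜ := by simpa using hs
      simp [hs, this]
    · have : s ∈ Gᶜ := by simpa using hs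
      simp [hs, this]
  simp only [e]
  exact sum_ite_mem_univ Gᶜ F

/-- `ν(S ∩ U) = p·ν'(a_S) + ν'(f_S 1_G)` for the slot `U = {b = t ∨ s ∈ G}`. [this work] -/
theorem mass_inter_slot_profile (w : B → ℝ) (ν' : Q → ℝ) (ν : B × Q → ℝ) (hν : ∀ b s, ν (b, s) = w b * ν' s) (t : B)
    (G : Finset Q) (U : Finset (B × Q)) (hU : ∀ x, x ∈ U ↔ (x.1 = t ∨ x.2 ∈ G)) (S : Finset (B × Q)) :
    ∑ x ∈ S ∩ U, ν x = w t * ∑ s, ν' s * (if (t, s) ∈ S then (1:ℝ) else 0)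
      + ∑ s ∈ G, ν' s * ∑ b ∈ univ.erase t, (if (b, s) ∈ S then w b else 0) := by
  have hmem : ∀ b s, ((b, s) ∈ S ∩ U) ↔ ((b, s) ∈ S ∧ (b = t ∨ s ∈ G)) := fun b s => by rw [Finset.mem_inter, hU]
  have key : ∀ s, ν' s * ∑ b, (if (b, s) ∈ S ∩ U then w b else 0) =
      w t * (ν' s * (if (t, s) ∈ S then (1:ℝ) else 0))
        + (if s ∈ G then ν' s * ∑ b ∈ univ.erase t, (if (b, s) ∈ S then w b else 0) else 0) := by
    intro s
    rw [sum_split_top w t]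
    by_cases hs : s ∈ G
    · have e2 : ∀ b, (if (b, s) ∈ S ∩ U then w b else 0) = (if (b, s) ∈ S then w b else 0) := by
        intro b; simp only [hmem, hs, or_true, and_true]
      simp only [e2, hs, ↓reduceIte]
      split_ifs <;> ring
    · have e2 : ∀ b ∈ univ.erase t, (if (b, s) ∈ S ∩ U then w b else 0) = 0 := by
        intro b hb
        have hbt : b ≠ t := (Finset.mem_erase.1 hb).1
        simp [hmem, hs, hbt]
      rw [Finset.sum_congr rfl e2, Finset.sum_const_zero, add_zero]
      simp only [hmem, hs, or_false, and_true, ↓reduceIte]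
      split_ifs <;> ring
  rw [mass_eq w ν' ν hν, Finset.sum_congr rfl (fun s _ => key s), Finset.sum_add_distrib, ← Finset.mul_sum,
    sum_ite_mem_univ]

/-- `ν(U) = p·Z' + q·ν'(G)`. [this work] -/
theorem mass_slot (w : B → ℝ) (ν' : Q → ℝ) (ν : B × Q → ℝ) (hν : ∀ b s, ν (b, s) = w b * ν' s) (t : B)
    (G : Finset Q) (U : Finset (B × Q)) (hU : ∀ x, x ∈ U ↔ (x.1 = t ∨ x.2 ∈ G)) :
    ∑ x ∈ U, ν x = w t * ∑ s, ν' s + (∑ b ∈ univ.erase t, w b) * ∑ s ∈ G, ν' s := by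
  have key : ∀ s, ν' s * ∑ b, (if (b, s) ∈ U then w b else 0) =
      w t * ν' s + (if s ∈ G then (∑ b ∈ univ.erase t, w b) * ν' s else 0) := by
    intro s
    rw [sum_split_top w t]
    have ht : ((t, s) ∈ U) := (hU (t, s)).2 (Or.inl rfl)
    have e2 : ∀ b ∈ univ.erase t, (if (b, s) ∈ U then w b else 0) = (if s ∈ G then w b else 0) := by
      intro b hb
      have hbt : b ≠ t := (Finset.mem_erase.1 hb).1
      simp [hU, hbt]
    rw [if_pos ht, Finset.sum_congr rfl e2]
    split_ifs
    · rw [Finset.sum_mul, mul_add, Finset.mul_sum]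
      congr 1
      · ring
      · exact Finset.sum_congr rfl fun b _ => by ring
    · simp [mul_comm]
  rw [mass_eq w ν' ν hν, Finset.sum_congr rfl (fun s _ => key s), Finset.sum_add_distrib, ← Finset.mul_sum,
    sum_ite_mem_univ, Finset.mul_sum, Finset.mul_sum]

/-- `ν(Uᶜ) = q·ν'(Gᶜ)`. [this work] -/
theorem mass_slot_compl (w : B → ℝ) (ν' : Q → ℝ) (ν : B × Q → ℝ) (hν : ∀ b s, ν (b, s) = w b * ν' s) (t : B)
    (G : Finset Q) (U : Finset (B × Q)) (hU : ∀ x, x ∈ U ↔ (x.1 = t ∨ x.2 ∈ G)) :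
    ∑ x ∈ Uᶜ, ν x = (∑ b ∈ univ.erase t, w b) * ∑ s ∈ Gᶜ, ν' s := by
  have key : ∀ s, ν' s * ∑ b, (if (b, s) ∈ Uᶜ then w b else 0) =
      (if s ∈ G then 0 else (∑ b ∈ univ.erase t, w b) * ν' s) := by
    intro s
    rw [sum_split_top w t]
    have ht : ¬ ((t, s) ∈ Uᶜ) := by rw [Finset.mem_compl, not_not]; exact (hU (t, s)).2 (Or.inl rfl)
    have e2 : ∀ b ∈ univ.erase t, (if (b, s) ∈ Uᶜ then w b else 0) = (if s ∈ G then 0 else w b) := by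
      intro b hb
      have hbt : b ≠ t := (Finset.mem_erase.1 hb).1
      by_cases hs : s ∈ G <;> simp [hU, hbt, hs]
    rw [if_neg ht, Finset.sum_congr rfl e2]
    split_ifs
    · simp
    · rw [zero_add, Finset.sum_mul, Finset.mul_sum]
      exact Finset.sum_congr rfl fun b _ => by ring
  rw [mass_eq w ν' ν hν, Finset.sum_congr rfl (fun s _ => key s), sum_ite_not_mem_univB, Finset.mul_sum]

omit [DecidableEq B] [DecidableEq Q] in
/-- Total mass `ν(univ) = (Σ w) Z'`. [folklore] -/
theorem mass_univ (w : B → ℝ) (ν' : Q → ℝ) (ν : B × Q → ℝ) (hν : ∀ b s, ν (b, s) = w b * ν' s) :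
    ∑ x, ν x = (∑ b, w b) * ∑ s, ν' s := by
  rw [Fintype.sum_prod_type, Finset.sum_mul]
  refine Finset.sum_congr rfl fun b _ => ?_
  rw [Finset.mul_sum]
  exact Finset.sum_congr rfl fun s _ => hν b s

/-- **Retained mass of the flat composite on `S ∩ S' ∩ U`** through the profiles: top fibre `p ν'(s)(c₁ − [s ∉ G] c₂)` on
`a a' = 1`, lower fibres `w_b (p ν'(s) + q R'(s))` on `G`, summing to `Σ_s aa'·p ν'(c₁ − [s∉G]c₂) + Σ_{s∈G} h (p ν' + q R')`. [this work] -/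
theorem retained_profile (w : B → ℝ) (ν' R' : Q → ℝ) (t : B) (G : Finset Q) (U : Finset (B × Q))
    (hU : ∀ x, x ∈ U ↔ (x.1 = t ∨ x.2 ∈ G)) (p q c₁ c₂ : ℝ) (S S' : Finset (B × Q)) :
    ∑ x ∈ (S ∩ S') ∩ U, (fun x : B × Q => if x.1 = t then p * ν' x.2 * (c₁ - (if x.2 ∈ G then 0 else c₂))
        else w x.1 * (p * ν' x.2 + q * R' x.2)) x =
      ∑ s, (if (t, s) ∈ S then (1:ℝ) else 0) * (if (t, s) ∈ S' then (1:ℝ) else 0) *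
          (p * ν' s * (c₁ - (if s ∈ G then 0 else c₂)))
      + ∑ s ∈ G, (∑ b ∈ univ.erase t, (if (b, s) ∈ S ∧ (b, s) ∈ S' then w b else 0)) * (p * ν' s + q * R' s) := by
  rw [sum_sectionsB]
  have e1 : ∑ s ∈ G, (∑ b ∈ univ.erase t, (if (b, s) ∈ S ∧ (b, s) ∈ S' then w b else 0)) * (p * ν' s + q * R' s) =
      ∑ s, (if s ∈ G then (∑ b ∈ univ.erase t, (if (b, s) ∈ S ∧ (b, s) ∈ S' then w b else 0)) * (p * ν' s + q * R' s) else 0) := by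
    rw [← Finset.sum_filter]; congr 1; ext s; simp
  rw [e1, ← Finset.sum_add_distrib]
  refine Finset.sum_congr rfl fun s _ => ?_
  rw [Finset.sum_filter, ← Finset.add_sum_erase univ _ (Finset.mem_univ t)]
  simp only [↓reduceIte, Finset.mem_inter]
  congr 1
  · have : ((t, s) ∈ U) := (hU (t, s)).2 (Or.inl rfl)
    by_cases h1 : (t, s) ∈ S <;> by_cases h2 : (t, s) ∈ S' <;> simp [h1, h2, this]
  · by_cases hs : s ∈ G
    · rw [if_pos hs, Finset.sum_mul]
      refine Finset.sum_congr rfl fun b hb => ?_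
      have hbt : b ≠ t := (Finset.mem_erase.1 hb).1
      have hbU : ((b, s) ∈ U) := (hU (b, s)).2 (Or.inr hs)
      by_cases h1 : (b, s) ∈ S <;> by_cases h2 : (b, s) ∈ S' <;> simp [h1, h2, hbt, hbU]
    · rw [if_neg hs]
      refine Finset.sum_eq_zero fun b hb => ?_
      have hbt : b ≠ t := (Finset.mem_erase.1 hb).1
      have hbU : ¬ ((b, s) ∈ U) := by rw [hU]; simp [hbt, hs]
      simp [hbU]

/-! ### Flow sums of the flat composite -/

/-- `Q`-sections of the slot and of its complement. [this work] -/
theorem secQ_slot (t : B) (G : Finset Q) (U : Finset (B × Q)) (hU : ∀ x, x ∈ U ↔ (x.1 = t ∨ x.2 ∈ G)) (b : B) :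
    univ.filter (fun s => (b, s) ∈ U) = (if b = t then univ else G) ∧
    univ.filter (fun s => (b, s) ∈ Uᶜ) = (if b = t then ∅ else Gᶜ) := by
  constructor
  · ext s; by_cases hb : b = t <;> simp [hU, hb]
  · ext s; by_cases hb : b = t <;> simp [hU, hb]

/-- In-flow of a receiver `(b,s)`, `b ≠ t`, `s ∉ G`: the vertical amount from `(t,s)` plus the scaled inner in-flow. [this work] -/
theorem flow_in (w : B → ℝ) (ν' : Q → ℝ) (Fl' : Q → Q → ℝ) (t : B) (G : Finset Q) (U : Finset (B × Q))
    (hU : ∀ x, x ∈ U ↔ (x.1 = t ∨ x.2 ∈ G)) (p q : ℝ) {b : B} (hb : b ≠ t) (s : Q) :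
    ∑ x ∈ U, (fun x y : B × Q => if y.1 = t then (0:ℝ) else if x.1 = t then (if x.2 = y.2 then p * w y.1 * ν' y.2 else 0)
        else (if x.1 = y.1 then q * w y.1 * Fl' x.2 y.2 else 0)) x (b, s) =
      p * w b * ν' s + q * w b * ∑ r ∈ G, Fl' r s := by
  rw [sum_sectionsQ, ← Finset.add_sum_erase univ _ (Finset.mem_univ t)]
  simp only [hb, ↓reduceIte]
  congr 1
  · rw [(secQ_slot t G U hU t).1, if_pos rfl, Finset.sum_ite_eq' univ s, if_pos (Finset.mem_univ s)]
  · rw [Finset.mul_sum, ← Finset.add_sum_erase (univ.erase t) _ (Finset.mem_erase.2 ⟨hb, Finset.mem_univ b⟩)]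
    rw [(secQ_slot t G U hU b).1, if_neg hb]
    have hz : ∑ b' ∈ (univ.erase t).erase b, ∑ r ∈ univ.filter (fun r => (b', r) ∈ U),
        (if b' = t then (if r = s then p * w b * ν' s else 0) else (if b' = b then q * w b * Fl' r s else 0)) = 0 := by
      refine Finset.sum_eq_zero fun b' hb' => ?_
      have h1 : b' ≠ b := (Finset.mem_erase.1 hb').1
      have h2 : b' ≠ t := (Finset.mem_erase.1 (Finset.mem_erase.1 hb').2).1
      simp [h1, h2]
    rw [hz, add_zero]
    exact Finset.sum_congr rfl fun r _ => by simp [hb]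

/-- Out-flow of a top source `(t,s)` to `Uᶜ`: `[s ∉ G]·p q ν'(s)` with `q = Σ_{b≠t} w_b`. [this work] -/
theorem flow_out_top (w : B → ℝ) (ν' : Q → ℝ) (Fl' : Q → Q → ℝ) (t : B) (G : Finset Q) (U : Finset (B × Q))
    (hU : ∀ x, x ∈ U ↔ (x.1 = t ∨ x.2 ∈ G)) (p q : ℝ) (s : Q) :
    ∑ y ∈ Uᶜ, (fun x y : B × Q => if y.1 = t then (0:ℝ) else if x.1 = t then (if x.2 = y.2 then p * w y.1 * ν' y.2 else 0)
        else (if x.1 = y.1 then q * w y.1 * Fl' x.2 y.2 else 0)) (t, s) y =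
      (if s ∈ G then 0 else p * ν' s * ∑ b ∈ univ.erase t, w b) := by
  rw [sum_sectionsQ, ← Finset.add_sum_erase univ _ (Finset.mem_univ t)]
  simp only [↓reduceIte]
  rw [(secQ_slot t G U hU t).2, if_pos rfl, Finset.sum_empty, zero_add]
  have e : ∀ b ∈ univ.erase t, ∑ y ∈ univ.filter (fun y => (b, y) ∈ Uᶜ), (if b = t then (0:ℝ) else if s = y then p * w b * ν' y else 0)
      = (if s ∈ G then 0 else p * ν' s * w b) := by
    intro b hb
    have hbt : b ≠ t := (Finset.mem_erase.1 hb).1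
    rw [(secQ_slot t G U hU b).2, if_neg hbt]
    simp only [hbt, ↓reduceIte]
    rw [Finset.sum_ite_eq Gᶜ s]
    by_cases hs : s ∈ G
    · have : s ∉ Gᶜ := by simpa using hs
      simp [hs, this]
    · have : s ∈ Gᶜ := by simpa using hs
      simp [hs, this]; ring
  rw [Finset.sum_congr rfl e]
  split_ifs
  · simp
  · rw [Finset.mul_sum]

/-- Out-flow of a lower source `(b,s)`, `b ≠ t`: the scaled inner out-flow. [this work] -/
theorem flow_out_low (w : B → ℝ) (ν' : Q → ℝ) (Fl' : Q → Q → ℝ) (t : B) (G : Finset Q) (U : Finset (B × Q))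
    (hU : ∀ x, x ∈ U ↔ (x.1 = t ∨ x.2 ∈ G)) (p q : ℝ) {b : B} (hb : b ≠ t) (s : Q) :
    ∑ y ∈ Uᶜ, (fun x y : B × Q => if y.1 = t then (0:ℝ) else if x.1 = t then (if x.2 = y.2 then p * w y.1 * ν' y.2 else 0)
        else (if x.1 = y.1 then q * w y.1 * Fl' x.2 y.2 else 0)) (b, s) y =
      q * w b * ∑ s' ∈ Gᶜ, Fl' s s' := by
  rw [sum_sectionsQ, ← Finset.add_sum_erase univ _ (Finset.mem_univ t)]
  simp only [hb, ↓reduceIte]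
  rw [(secQ_slot t G U hU t).2, if_pos rfl, Finset.sum_empty, zero_add,
    ← Finset.add_sum_erase (univ.erase t) _ (Finset.mem_erase.2 ⟨hb, Finset.mem_univ b⟩)]
  rw [(secQ_slot t G U hU b).2, if_neg hb]
  simp only [hb, ↓reduceIte]
  have hz : ∑ b' ∈ (univ.erase t).erase b, ∑ y ∈ univ.filter (fun y => (b', y) ∈ Uᶜ),
      (if b' = t then (0:ℝ) else if b = b' then q * w b' * Fl' s y else 0) = 0 := by
    refine Finset.sum_eq_zero fun b' hb' => ?_
    have h1 : b' ≠ b := (Finset.mem_erase.1 hb').1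
    have h2 : b' ≠ t := (Finset.mem_erase.1 (Finset.mem_erase.1 hb').2).1
    simp [Ne.symm h1, h2]
  rw [hz, add_zero, Finset.mul_sum]

/-! ### Profiles of up-sets: pointwise constraints -/

section Profiles

variable [PartialOrder B] [PartialOrder Q]

omit [Fintype B] [Fintype Q] in
/-- The top profile `a_S = [ (t,·) ∈ S ]` of an up-set is monotone. [folklore] -/
theorem profile_a_mono {S : Finset (B × Q)} (hS : IsUpperSet (S : Set (B × Q))) (t : B) :
    Monotone (fun s => if (t, s) ∈ S then (1:ℝ) else 0) := by
  intro s s' hss'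
  dsimp only
  by_cases hs : (t, s) ∈ S
  · have : (t, s') ∈ S := hS (Prod.mk_le_mk.2 ⟨le_rfl, hss'⟩) hs
    rw [if_pos hs, if_pos this]
  · rw [if_neg hs]; split_ifs <;> norm_num

omit [Fintype Q] in
/-- The lower profile `f_S(s) = Σ_{b ≠ t} w_b [ (b,s) ∈ S ]` of an up-set is monotone (`w ≥ 0`). [folklore] -/
theorem profile_f_mono {w : B → ℝ} (hw : ∀ b, 0 ≤ w b) {S : Finset (B × Q)} (hS : IsUpperSet (S : Set (B × Q))) (t : B) :
    Monotone (fun s => ∑ b ∈ univ.erase t, (if (b, s) ∈ S then w b else 0)) := by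
  intro s s' hss'
  refine Finset.sum_le_sum fun b _ => ?_
  by_cases hs : (b, s) ∈ S
  · have : (b, s') ∈ S := hS (Prod.mk_le_mk.2 ⟨le_rfl, hss'⟩) hs
    rw [if_pos hs, if_pos this]
  · rw [if_neg hs]; split_ifs; exacts [hw b, le_rfl]

omit [Fintype Q] in
/-- The joint profile `h(s) = Σ_{b ≠ t} w_b [ (b,s) ∈ S ∩ S' ]` is monotone. [folklore] -/
theorem profile_h_mono {w : B → ℝ} (hw : ∀ b, 0 ≤ w b) {S S' : Finset (B × Q)} (hS : IsUpperSet (S : Set (B × Q)))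
    (hS' : IsUpperSet (S' : Set (B × Q))) (t : B) :
    Monotone (fun s => ∑ b ∈ univ.erase t, (if (b, s) ∈ S ∧ (b, s) ∈ S' then w b else 0)) := by
  intro s s' hss'
  refine Finset.sum_le_sum fun b _ => ?_
  by_cases hs : (b, s) ∈ S ∧ (b, s) ∈ S'
  · have h1 : (b, s') ∈ S := hS (Prod.mk_le_mk.2 ⟨le_rfl, hss'⟩) hs.1
    have h2 : (b, s') ∈ S' := hS' (Prod.mk_le_mk.2 ⟨le_rfl, hss'⟩) hs.2
    rw [if_pos hs, if_pos ⟨h1, h2⟩]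
  · rw [if_neg hs]; split_ifs; exacts [hw b, le_rfl]

omit [Fintype Q] in
/-- `0 ≤ f_S(s) ≤ q · a_S(s)` with `q = Σ_{b≠t} w_b`, for an up-set `S` and a top element `t`. [this work] -/
theorem profile_f_bounds {w : B → ℝ} (hw : ∀ b, 0 ≤ w b) {S : Finset (B × Q)} (hS : IsUpperSet (S : Set (B × Q)))
    {t : B} (ht : ∀ b, b ≤ t) (s : Q) :
    0 ≤ ∑ b ∈ univ.erase t, (if (b, s) ∈ S then w b else 0) ∧
    ∑ b ∈ univ.erase t, (if (b, s) ∈ S then w b else 0) ≤ (∑ b ∈ univ.erase t, w b) * (if (t, s) ∈ S then (1:ℝ) else 0) := by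
  refine ⟨Finset.sum_nonneg fun b _ => by split_ifs; exacts [hw b, le_rfl], ?_⟩
  by_cases hts : (t, s) ∈ S
  · rw [if_pos hts, mul_one]
    exact Finset.sum_le_sum fun b _ => by split_ifs; exacts [le_rfl, hw b]
  · rw [if_neg hts, mul_zero]
    refine (Finset.sum_eq_zero fun b _ => ?_).le
    rw [if_neg]
    exact fun hb => hts (hS (Prod.mk_le_mk.2 ⟨ht b, le_rfl⟩) hb)

omit [Fintype Q] [PartialOrder B] [PartialOrder Q] in
/-- `0 ≤ h ≤ f_S` and `h ≤ f_{S'}`. [folklore] -/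
theorem profile_h_bounds {w : B → ℝ} (hw : ∀ b, 0 ≤ w b) (S S' : Finset (B × Q)) (t : B) (s : Q) :
    0 ≤ ∑ b ∈ univ.erase t, (if (b, s) ∈ S ∧ (b, s) ∈ S' then w b else 0) ∧
    ∑ b ∈ univ.erase t, (if (b, s) ∈ S ∧ (b, s) ∈ S' then w b else 0) ≤ ∑ b ∈ univ.erase t, (if (b, s) ∈ S then w b else 0) ∧
    ∑ b ∈ univ.erase t, (if (b, s) ∈ S ∧ (b, s) ∈ S' then w b else 0) ≤ ∑ b ∈ univ.erase t, (if (b, s) ∈ S' then w b else 0) := by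
  refine ⟨Finset.sum_nonneg fun b _ => by split_ifs; exacts [hw b, le_rfl], Finset.sum_le_sum fun b _ => ?_,
    Finset.sum_le_sum fun b _ => ?_⟩
  · by_cases h : (b, s) ∈ S ∧ (b, s) ∈ S'
    · rw [if_pos h, if_pos h.1]
    · rw [if_neg h]; split_ifs; exacts [hw b, le_rfl]
  · by_cases h : (b, s) ∈ S ∧ (b, s) ∈ S'
    · rw [if_pos h, if_pos h.2]
    · rw [if_neg h]; split_ifs; exacts [hw b, le_rfl]

omit [Fintype Q] in
/-- **Harris on the block, pointwise in profile form**: `(p a + f)(p a' + f') ≤ W·(p aa' + h)` at every `s ∈ Q`, from Harris'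
inequality for up-sets of `B` (`W = Σ w`). [this work] -/
theorem harrisB_profile {w : B → ℝ}
    (hHB : ∀ I J : Finset B, IsUpperSet (I : Set B) → IsUpperSet (J : Set B) →
      (∑ b ∈ I, w b) * (∑ b ∈ J, w b) ≤ (∑ b, w b) * ∑ b ∈ I ∩ J, w b)
    {S S' : Finset (B × Q)} (hS : IsUpperSet (S : Set (B × Q))) (hS' : IsUpperSet (S' : Set (B × Q))) (t : B) (s : Q) :
    (w t * (if (t, s) ∈ S then (1:ℝ) else 0) + ∑ b ∈ univ.erase t, (if (b, s) ∈ S then w b else 0)) *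
      (w t * (if (t, s) ∈ S' then (1:ℝ) else 0) + ∑ b ∈ univ.erase t, (if (b, s) ∈ S' then w b else 0)) ≤
    (∑ b, w b) * (w t * ((if (t, s) ∈ S then (1:ℝ) else 0) * (if (t, s) ∈ S' then (1:ℝ) else 0))
      + ∑ b ∈ univ.erase t, (if (b, s) ∈ S ∧ (b, s) ∈ S' then w b else 0)) := by
  have key := hHB (univ.filter fun b => (b, s) ∈ S) (univ.filter fun b => (b, s) ∈ S') (isUpperSet_secB hS s)
    (isUpperSet_secB hS' s)
  have e1 : ∀ X : Finset (B × Q), ∑ b ∈ univ.filter (fun b => (b, s) ∈ X), w b =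
      w t * (if (t, s) ∈ X then (1:ℝ) else 0) + ∑ b ∈ univ.erase t, (if (b, s) ∈ X then w b else 0) := by
    intro X
    rw [Finset.sum_filter, sum_split_top w t]
    split_ifs <;> ring
  have e2 : ∑ b ∈ univ.filter (fun b => (b, s) ∈ S) ∩ univ.filter (fun b => (b, s) ∈ S'), w b =
      w t * ((if (t, s) ∈ S then (1:ℝ) else 0) * (if (t, s) ∈ S' then (1:ℝ) else 0))
        + ∑ b ∈ univ.erase t, (if (b, s) ∈ S ∧ (b, s) ∈ S' then w b else 0) := by
    have : univ.filter (fun b => (b, s) ∈ S) ∩ univ.filter (fun b => (b, s) ∈ S') =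
        univ.filter (fun b => (b, s) ∈ S ∧ (b, s) ∈ S') := by ext b; simp
    rw [this, Finset.sum_filter, sum_split_top w t]
    by_cases h1 : (t, s) ∈ S <;> by_cases h2 : (t, s) ∈ S' <;> simp [h1, h2]
  rw [e1, e1, e2] at key
  exact key

end Profiles

end Summit.CriticalPhenomena.PercolationContinuityZ3.Theorems.SahiE3BlockLayers
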